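import Summits.BirchSwinnertonDyer.BirchSwinnertonDyer.Theses.UniversalToricDescent
import Summits.BirchSwinnertonDyer.BirchSwinnertonDyer.Theorems.WildThreeRankOneBSDpOfExactIndexManin
import Summits.BirchSwinnertonDyer.BirchSwinnertonDyer.Theorems.SchneiderFreeAdditiveX3UpperReceptacle
import Summits.BirchSwinnertonDyer.BirchSwinnertonDyer.Theorems.ClassRecordThreeStepLOfHalvesB
import Literature.NumberTheory.EllipticCurves.BSDHeegnerPointsGrossZagierProofs
import Literature.NumberTheory.EllipticCurves.KrizLi2019.SexticTwistBSDThreeDescent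
import Literature.NumberTheory.EllipticCurves.GlobalMinimalModelProofs
import Literature.NumberTheory.EllipticCurves.ModularCurveManinConstantProofs
import HarnessLib

/-!
# Route `UniversalToricDescent`, support item `ToricKernelAtThree` (stmt-BirchSwinnertonDyer-20390):
# THE KERNEL — published inputs → transport → twin IMC → Waldspurger frame → control → rank-zero
# twist ⟹ `BSD₃(E)` on the attacked wild cell, PROVED (Jetchev–Skinner–Wan §7.4 at the wild split
# prime `3`, Manin-robust)

Cell `bsd-wall` (W-ALL, lane 3), seat `bsd-wall-utd-p3` (prover, gen 0), 2026-08-27. Closes the support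
item `ToricKernelAtThree` of route `route-BirchSwinnertonDyer-UniversalToricDescent` (rev 14): the theorem
below has LITERALLY the type `Summit.BirchSwinnertonDyer.BirchSwinnertonDyer.Theses.UniversalToricDescent.ToricKernelAtThree`.

## The assembly (every step a tree theorem; the cruxes enter as the item's antecedents)

For `E/ℚ` (globally minimal `W`) on the wild class `ClassO6 W 3` with `ρ̄_{E,3}` onto, `r_an(E) = 1`, and
a semistable-at-`3` onto twin `W′` (`ModPCongruent W′ W 3`, `¬ Addv W′ 3`):

* (a) DATA. Parity (`r_an` odd ⟹ `w(E) = −1`) and Friedberg–Hoffstein Thm. B with the auxiliary modulus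
  `M = 2·N(E′)` give an imaginary quadratic `K` with the Heegner hypothesis for `N(E)`, for `N(E′)` AND
  with `2` split — so `d_K ≡ 1 (mod 8)` is ODD (`SatisfiesHeegnerHypothesis.discr_emod_eight`) — and
  `L(E^{d_K},1) ≠ 0`; `exists_isHeegnerPoint` gives `(Dt, H, ι, P)`, Gross–Zagier makes `P` non-torsion
  (`L′(E/K,1) = L′(E,1)·L(E^{d_K},1) ≠ 0`), Kolyvagin gives `rank E(K) = 1` and `Ш(E/K)` finite; modularity
  gives the twin's datum `Dt′`. A frame: the anticyclotomic `κ` with generator `γ`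
  (`X11b.exists_anticyclotomic_generator_prime`), a degree-one `𝔭 ∋ 3` (`3 ∣ N(E)` splits) and THE OTHER
  degree-one prime `𝔭′ ≠ 𝔭` (`X11b.Three.exists_ne_degreeOne_prime`).
* (b) PLUMBING. `WildSplitWaldspurgerAtThree` at `(κ, γ, 𝔭)`: `ι′` inducing `𝔭`, a BDP frame `L ∈ R₀⟦T⟧`
  for `Dt.f`, and `L(𝟙) = u·(log_𝔭 P / c)²` with `u ∈ R₀ˣ`. `TwinSplitIMCAtThree` at
  `(W′, 𝔭, 𝔭′, ι′)` feeds `ToricTransportModThree`, whence `Ch_Λ(X_ac(E/K) strict at 𝔭′)·R₀⟦T⟧ = (L)`.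
  `WildSplitControlAtThree` at `𝔭′` gives the control count (in particular CTL₀ at `𝔭′`). The value is
  moved to the logarithm at `𝔭′` (`(log_{𝔭′} P)² = (log_𝔭 P)²` in rank one, K1's
  `hasValueAt_sq_logOmega_embAt_iff_of_rank_one`). The two norm receptacles
  (`Supersingular.two_mul_valuation_le_of_mem_span`, inclusion `⊆` — inlined here, route-free;
  `SchneiderFree.Upper.additiveIMCUpperBDPOnTreeLeAt_of_value_of_dvd'`, inclusion `⊇`, UNIT cofactor) turn
  the EQUALITY + value into both sockets at slack `v₃(c)` at the frame `(κ, 𝔭′, γ, embAt 𝔭′)`, and K1's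
  links (`indexLowerBoundLeAt_of_imcLowerLe_of_control`, `Upper.indexUpperBoundLeAt_of_imcUpperLe_of_control`)
  read them with the control EQUALITY as the EXACT index
  `2·v₃[E(K):ℤP] = v₃#Ш(E/K) + 2·v₃∏c_ℓ + 2·v₃(c)` (both halves).
* (c) TERMINAL STEP = bsd-potss-kmc g17's p528981
  `SchneiderFree.Exact.bsdp_three_of_exactIndexManin_of_wAllExclAddWildRankZero`: the rank-zero wild leaf
  (`WildRankZeroTwistAtThree = WAllExclAddWildRankZero`, an antecedent) pays `BSD₃` of a minimal model of
  `E^{d_K}` (again a non-CM O6 row, `r_an = 0`), and the exact index descends to `BSD₃(E)`.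

HONEST FRAMING: this closes a SUPPORT item (pure assembly); every crux of the route
(`ToricTransportModThree`, `TwinSplitIMCAtThree`, `WildSplitWaldspurgerAtThree`, `WildSplitControlAtThree`,
`WildRankZeroTwistAtThree`) and the published inputs are ANTECEDENTS of the statement proved; BSD is not
proved for any curve by this file. No definition, no named fact, no `sorry`.

References: [JetchevSkinnerWan2017] §7.4.1 (arXiv:1512.06894 p. 30); [Castella2018] Thm. 2.3, §5
(5.1)–(5.3); [GrossZagier1986] Thm. I.(6.3), V.§2; [FriedbergHoffstein1995] Thm. B; [Gross1991] (1.1),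
Thm. 1.3.
-/

noncomputable section

open scoped Classical

set_option linter.dupNamespace false
set_option autoImplicit false

namespace Summit.BirchSwinnertonDyer.BirchSwinnertonDyer.Theorems

open WeierstrassCurve NumberField IsDedekindDomain Field
  Literature.NumberTheory.EllipticCurves
  Literature.NumberTheory.EllipticCurves.ModularForms
  Literature.NumberTheory.EllipticCurves.Rank1Residual
  Literature.NumberTheory.EllipticCurves.KrizLi2019
  Summit.BirchSwinnertonDyer.Rank1Residual
  Summit.BirchSwinnertonDyer.Rank1Residual.Additive
  Summit.BirchSwinnertonDyer.Rank1Residual.X11b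
  Summit.BirchSwinnertonDyer.Rank1Residual.X11b.AcSelmer
  Summit.BirchSwinnertonDyer.Rank1Residual.X11b.Halves
  Summit.BirchSwinnertonDyer.BirchSwinnertonDyer.Theses.UniversalToricDescent

/-- **Item `ToricKernelAtThree` (stmt-BirchSwinnertonDyer-20390) of route `UniversalToricDescent` holds**:
published inputs → `ToricTransportModThree` → `TwinSplitIMCAtThree` → `WildSplitWaldspurgerAtThree` →
`WildSplitControlAtThree` → `WildRankZeroTwistAtThree` ⟹ `BSD₃(E)` for every globally minimal `E/ℚ` on
`ClassO6 W 3` with `r_an = 1`, `ρ̄_{E,3}` onto and a semistable-at-`3` onto twin. Jetchev–Skinner–Wan's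
§7.4 assembly at the wild split prime `3` with the Manin constant kept on both sides: Friedberg–Hoffstein
field (`2` and all of `N(E)N(E′)` split), Heegner point, Gross–Zagier, Kolyvagin, frame `(κ, γ, 𝔭, 𝔭′)`,
Waldspurger value at `𝔭`, IMC equality at `E` by transport from the twin (X_ac strict at `𝔭′`), control
at `𝔭′`, `(log_{𝔭′}P)² = (log_𝔭 P)²`, both norm receptacles ⟹ exact index at slack `v₃(c)` ⟹ p528981.
[cite: JetchevSkinnerWan2017, §7.4.1 (arXiv:1512.06894 p. 30)] [cite: Castella2018, Thm. 2.3 and §5 (5.1)–(5.3)]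
[cite: GrossZagier1986, Thm. I.(6.3) and V.§2] [cite: FriedbergHoffstein1995, Thm. B] -/
theorem universalToricDescent_toricKernelAtThree_proof : ToricKernelAtThree := by
  unfold ToricKernelAtThree
  intro hF hT hI hV hC hZ W _ _ hO6 hr hsurj htwin
  obtain ⟨W', hW'e, hW'm, hcong, hW'ss, hW'surj⟩ := htwin
  obtain ⟨hGZ, hKo, hGZK, hmod, hmodP, -, hGZ73, hFH, hpar, hHP⟩ := hF
  haveI hN0 : NeZero (W.conductorNorm ℤ) := ⟨W.conductorNorm_pos_holds.ne'⟩
  haveI hN0' : NeZero (W'.conductorNorm ℤ) := ⟨W'.conductorNorm_pos_holds.ne'⟩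
  -- (a) DATA. parity: `r_an = 1` is odd, so `w(E) = -1`
  have hw : W.rootNumber = -1 := by
    rcases W.rootNumber_eq_one_or with h | h
    · exfalso
      have heven : Even W.analyticRank := (hpar W).mpr h
      rw [hr] at heven
      exact Nat.not_even_one heven
    · exact h
  -- Friedberg–Hoffstein with auxiliary modulus `2·N(E′)`: Heegner for `N(E)`, `N(E′)`, and `2` split
  obtain ⟨K, _, _, hK, -, hHN, hH2N', hLt⟩ :=
    hFH W hw (2 * W'.conductorNorm ℤ) (mul_ne_zero two_ne_zero hN0'.out) 0
  have hHN' : SatisfiesHeegnerHypothesis (W'.conductorNorm ℤ) K :=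
    SatisfiesHeegnerHypothesis.of_dvd (dvd_mul_left _ 2) hH2N'
  have hodd : Odd (NumberField.discr K) := by
    have h8 := Literature.SatisfiesHeegnerHypothesis.discr_emod_eight hK.1 hH2N' (dvd_mul_right 2 _)
    rw [Int.odd_iff]; omega
  -- `3 ∣ N(E)` (additive) splits in `K`
  have h3N : 3 ∣ W.conductorNorm ℤ :=
    (W.dvd_conductorNorm_iff_not_hasGoodReductionAtPrime 3).mpr (not_good_of_addv W 3 hO6.2.1)
  have hsplit : SplitsIn K 3 := hHN 3 Nat.prime_three h3N
  -- the Heegner point over `K` and its data; non-torsion by Gross–Zagier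
  obtain ⟨P, Dt, H, ι, hP⟩ := hHP W K hK hHN
  have hL0 : W.entireLFunction 1 = 0 := entireLFunction_one_eq_zero_of_analyticRank_eq_one hr
  obtain ⟨-, hderiv⟩ := leadingLCoeff_eq_deriv_of_analyticRank_eq_one hr
  have hLK : LDerivEK W K ≠ 0 := by
    rw [lDerivEK_eq_deriv_mul W K hmod hL0]; exact mul_ne_zero hderiv hLt
  have hnt : ¬ IsOfFinAddOrder P :=
    (lDerivEK_ne_zero_iff_not_isOfFinAddOrder W (W.conductorNorm ℤ) K (hGZ _ W K) hK hHN
      ⟨Dt, H, ι, hP⟩).mp hLK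
  -- Kolyvagin: `rank E(K) = 1`, `Ш(E/K)` finite
  obtain ⟨hrk, hfin⟩ := hKo (W.conductorNorm ℤ) W K hK hHN ⟨Dt, H, ι, hP⟩ hnt
  -- the twin's parametrisation datum (modularity)
  obtain ⟨Dt'⟩ := hmodP W'
  -- a frame `(κ, γ, 𝔭)` and the other prime `𝔭′ ≠ 𝔭` above `3`
  obtain ⟨κ, γ, -, hκ, hγ, -⟩ := X11b.exists_anticyclotomic_generator_prime (p := 3) hK
  haveI : Fact (κ.IsTopGenerator γ) := ⟨hγ⟩
  obtain ⟨𝔭, h𝔭, he, hf⟩ := X11b.exists_degreeOnePrime_of_splitsIn K 3 hK.1 hsplit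
  obtain ⟨𝔭', hne, h𝔭', he', hf'⟩ := X11b.Three.exists_ne_degreeOne_prime hK.1 h𝔭 he hf
  -- (b) PLUMBING. Waldspurger frame and unit value at `(κ, γ, 𝔭)`
  obtain ⟨ι', hind, ΩK, Ωp, L, hΩK, hΩp, hBDP, u, hval⟩ :=
    hV W (W.conductorNorm ℤ) K Dt H ι P hO6 hsurj hr rfl hK hHN hLt hP hnt κ hκ γ 𝔭 h𝔭 he hf
  -- the twin's IMC at `(ι′, 𝔭)` with `X_ac` strict at `𝔭′`
  obtain ⟨hex', hall'⟩ :=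
    hI W' (W'.conductorNorm ℤ) K Dt' hW'ss hW'surj rfl hK hHN' κ hκ γ 𝔭 h𝔭 he hf 𝔭' h𝔭' hne ι' hind
  -- transport: IMC EQUALITY for `E` at the frame `L`
  have heq : (XAc.charIdeal (W.baseChange K) 3 κ 𝔭' ∅ γ).map (PowerSeries.map (toUnr 3)) =
      Ideal.span {L} :=
    hT W W' (W.conductorNorm ℤ) (W'.conductorNorm ℤ) K Dt Dt' hO6 hsurj hr rfl hcong hW'ss rfl hK hHN
      hHN' κ hκ γ 𝔭 h𝔭 he hf 𝔭' h𝔭' hne ι' hind hex' hall' ΩK Ωp L hΩK hΩp hBDP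
  -- control EQUALITY at `𝔭′` (CTL₀ included)
  have hctl : SchneiderFree.AdditiveControlOnTreeAt 3 κ 𝔭' γ (embAt K 3 𝔭' h𝔭' he' hf') P :=
    hC W (W.conductorNorm ℤ) K Dt H ι P hO6 hsurj hr rfl hK hHN hLt hP hnt (hKo _ W K) κ hκ γ 𝔭'
      h𝔭' he' hf'
  obtain ⟨n, hn, hneq⟩ := hctl
  -- the value read through the logarithm at `𝔭′` (rank one: `(log_{𝔭′} P)² = (log_𝔭 P)²`)
  have hval' : L.HasValueAt 0 ((((u : unrIntegers 3) : unrIntegers 3) : ℂ_[3]) *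
      (algebraMap ℚ_[3] ℂ_[3]
        (logOmega W 3 (embAt K 3 𝔭' h𝔭' he' hf') P / (Dt.c : ℚ_[3]))) ^ 2) :=
    (SchneiderFreeAdditiveX3.hasValueAt_sq_logOmega_embAt_iff_of_rank_one W 3 hK.1 hrk h𝔭 he hf
      h𝔭' he' hf' P _ _ L).mpr hval
  -- both sockets at slack `v₃(c)` at the frame `(κ, 𝔭′, γ, embAt 𝔭′)`
  have hc0 : Dt.c ≠ 0 := Dt.maninConstant_ne_zero_holds
  have hlog : logOmega W 3 (embAt K 3 𝔭' h𝔭' he' hf') P ≠ 0 := X11b.R1.logOmega_ne_zero W 3 _ hnt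
  have hlow : SchneiderFree.AdditiveIMCLowerBDPOnTreeLeAt 3 κ 𝔭' γ (embAt K 3 𝔭' h𝔭' he' hf')
      (padicValNat 3 Dt.c.natAbs) P := by
    -- the LOWER norm receptacle (`⊆` + value): `2·ord₃(log_{𝔭′}P / c) ≤ ord₃ f(0)`
    obtain ⟨htors, f, hfI, hf0, hfn⟩ := hn
    have hmem : PowerSeries.map (toUnr 3) f ∈ Ideal.span {L} := by
      have h3 := heq.le
      rw [hfI, CongruenceLimit.map_span_singleton_powerSeries] at h3
      exact (Ideal.span_singleton_le_iff_mem _).mp h3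
    obtain ⟨-, hle⟩ := Supersingular.two_mul_valuation_le_of_mem_span 3 hf0 hmem u hval'
    have hc0' : (Dt.c : ℚ_[3]) ≠ 0 := by exact_mod_cast hc0
    rw [div_eq_mul_inv, Padic.valuation_mul hlog (inv_ne_zero hc0'), Padic.valuation_inv,
      Padic.valuation_intCast, valuation_logOmega hlog, hfn] at hle
    refine ⟨n, ⟨htors, f, hfI, hf0, hfn⟩, ?_⟩
    simp only [padicValInt] at hle
    linarith
  have hup : SchneiderFree.Upper.AdditiveIMCUpperBDPOnTreeLeAt 3 κ 𝔭' γ (embAt K 3 𝔭' h𝔭' he' hf')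
      (padicValNat 3 Dt.c.natAbs) P :=
    SchneiderFree.Upper.additiveIMCUpperBDPOnTreeLeAt_of_value_of_dvd' hn heq.ge u hc0 hlog hval'
  -- the EXACT index at slack `v₃(c)` (both halves), by K1's links with the control equality
  have hlo : SchneiderFree.IndexLowerBoundLeAt W 3 K P (padicValNat 3 Dt.c.natAbs) :=
    SchneiderFreeAdditiveX3.indexLowerBoundLeAt_of_imcLowerLe_of_control rfl hK hHN hfin hlow
      ⟨n, hn, hneq⟩
  have hupI : SchneiderFree.Upper.IndexUpperBoundLeAt W 3 K P (padicValNat 3 Dt.c.natAbs) :=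
    SchneiderFree.Upper.indexUpperBoundLeAt_of_imcUpperLe_of_control rfl hK hHN hfin hup ⟨n, hn, hneq⟩
  -- (c) TERMINAL STEP: a globally minimal model of the twist, then p528981
  have hD0 : (NumberField.discr K : ℚ) ≠ 0 := by exact_mod_cast NumberField.discr_ne_zero K
  haveI : (W.quadraticTwist (NumberField.discr K : ℚ)).IsElliptic := W.isElliptic_quadraticTwist hD0
  obtain ⟨Cd, hCd⟩ := hasGlobalMinimalModel_rat_holds (W.quadraticTwist (NumberField.discr K : ℚ))
  haveI : (Cd • W.quadraticTwist (NumberField.discr K : ℚ)).IsGloballyMinimal := hCd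
  exact SchneiderFree.Exact.bsdp_three_of_exactIndexManin_of_wAllExclAddWildRankZero hGZ hKo hGZK hmod
    hGZ73 hZ W hO6 hsurj hr (W.conductorNorm ℤ) K Dt H ι P
    (Cd • W.quadraticTwist (NumberField.discr K : ℚ)) rfl hK hodd hHN hLt hP ⟨Cd, rfl⟩ hlo hupI

end Summit.BirchSwinnertonDyer.BirchSwinnertonDyer.Theorems

end
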